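import Summits.AtomisticToContinuum.FouriersLaw.Theses.EmbeddedDrudeMourre
import Summits.AtomisticToContinuum.FouriersLaw.Theses.FourierGreenKubo
import Literature.MathematicalPhysics.KineticTheory.InfiniteChainGibbsScaling
import Literature.MathematicalPhysics.KineticTheory.InfiniteChainAmplitudeScaling

/-!
# Disproof of `GreenKuboContinuation` (stmt-AtomisticToContinuum-12597) — findings of the standing adversary

Crux (route `EmbeddedDrudeMourre`, rank 5, "regime boundary / import slot"):
`GreenKuboContinuation := ∀ (ω₂ lam β γ) > 0, ∀ T₀ > 0, (∀ T ∈ (0,T₀), W T) → ∀ T > 0, W T`, where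
`W T = AbelWitness ω₂ lam β γ T` := some DLR Gibbs state `μT` of `pinnedChain ω₂ lam β γ` at `T`,
some `μT`-preserving `InfiniteChainDynamics` with absolutely convergent current correlations
`C(t) = Σ_x ∫ j₀ (j_x ∘ φ_t) dμT`, and some `κ > 0` with `T⁻² ∫₀^∞ e^{-νt} C(t) dt → κ` (`ν ↓ 0`).

VERDICT (cycle 2, 2026-08-15): **RESISTS — not refuted, and not refutable with anything in print.**
By `not_continuesAlong_iff` a disproof must (i) PRODUCE Abelian Green–Kubo witnesses on a whole
initial temperature segment of one pinned doubly-quartic chain — the kinetic-corner conjecture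
(ALS06 phonon Boltzmann picture; no theorem produces a positive finite conductivity for ANY
deterministic anharmonic lattice) — and (ii) DESTROY every witness at one `T ≥ T₀`: `κ_A = ∞`
(ballistic/anomalous: excluded heuristically by pinning — no momentum conservation — and by all
numerics on pinned anharmonic chains, BLR2000 §10 item 1, Aoki–Kusnezov 2000 `κ ∝ T^{-1.35}`),
`κ_A = 0` (classical many-body localisation at `T > 0`: De Roeck–Huveneers 2015 prove only
finite-time UPPER bounds in an anti-continuum corner of OTHER chains and write, after their Thm 2,
"we do not even rigorously know whether the chains we consider are normal conductors for some
`ε > 0`" and "we expect localization of energy to be at best asymptotic"; the quartic chain is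
their declared open question (2.12) — quotes as vendored in the tree barrier file
`Literature/Barriers/AtomisticToContinuum/AnticontinuumLocalization.lean`), or a non-existent
Abel limit (no mechanism known). Both (i) and (ii) would be first-rank results on their own.
Printed evidence AGAINST a transport transition along a ray (materialised texts, this seat):
ALS06 §5 (held as `paper:galaxy-pdf-1225612559323412660`, chunks p0049/p0119): Nosé–Hoover MD of
the harmonic-coupling quartic-pinning chain gives finite `κ` at `T = 0.1, 0.4, 4` with
`T²κ(T)` following the kinetic line (Fig. 5) and mean free path "from `Λ ∼ 1` at `T = 4`,
`δ = 0.3` to `Λ ∼ 4000` at `T = 0.1`, `δ = 0.08`" — 1.5 decades outward from the corner, no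
anomaly (this is the `β = 0` edge of the coupling quadrant); the 2008 review/thesis "Thermal
conduction in nanoscale systems" (`paper:galaxy-pdf-5117471256757086060` p0011): "The `φ⁴` model,
which includes a quartic on-site potential … also presents normal thermal conductivity [18, 19]
… momentum conservation plays an important role in obtaining abnormal thermal conductivity";
BLR2000 §10 item 1 "one finds a finite conductivity if some nonlinearity is present" (quoted in
`LowTemperatureWeakAnharmonicity.lean`). Rays with `β > 0` end in the scale-free doubly-quartic
chain (MD probe j006847 of this seat queued: far end `b/a ∈ {1, 0.2, 0.05}` and two rays at
`c ∈ {0.3, 3, 30}`; numbers to be appended). `lit search`/galaxy were DEGRADED (rc 75) during this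
cycle; no downgrade of anything rests on a search that could not run.
MECHANISM CENSUS for half (ii) (why each known route to "no witness at some finite `T`" misses
THIS chain): (1) momentum conservation ⇒ `κ ~ N^{1/3}` anomaly — absent (`ω₂, lam > 0` pin the
chain); (2) an exact extra local conservation law (integrable point) ⇒ Mazur/Drude atom,
`not_tendsto_of_drude_floor` — but conservation laws do not depend on `T`: such a charge kills
the witnesses at EVERY temperature of the ray, hence also the corner hypothesis, and the crux
becomes VACUOUSLY true there (`continuesAlong_of_noCorner`) — integrable exceptional couplings can
never refute this crux; only a conservation law of the `T → ∞` LIMIT model (the pure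
doubly-quartic chain) could act asymptotically, and that gives fast-growing but finite `κ(T)`;
(3) disorder-free (anti-continuum) localisation, De Roeck–Huveneers — makes `κ` super-polynomially
small on the stretch `b/a ≪ 1` of a ray, never `0` at finite `T` by any printed result, and the far
end of every ray with `b > 0` is the scale-free quartic chain (`κ₄(T) = T^{1/4}κ₄(1)` by the exact
quartic scaling `(q,p,t) ↦ (μq, μ²p, t/μ)`), outside DRH's on-site-dominated class; (4) breathers /
slow energy lumps (barrier `StrongPinningBreathers*`) — immobile in a pinned lattice, they scatter
rather than carry current; a broad lifetime distribution lengthens the tail of `C(t)` but no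
mechanism for a non-integrable tail without a conserved current is in print; (5) a non-existent
Abel limit needs a non-absolutely-integrable oscillating tail of `C(t)` — no mechanism at `T > 0`.
Conversely half (i) is blocked by the absence of ANY theorem producing a positive finite
conductivity for a deterministic anharmonic lattice (BLR2000 §7: "not even clear how to prove …
`κ = κ_GK`").
What the provers should take from this file:

## Findings index (all PROVED, `lean check` rc 0, no `sorry`)

§1 SHAPE — `greenKuboContinuation_iff` (`Iff.rfl`: the crux is `ContinuesAlong (AbelWitness …)`),
  `continuesAlong_iff_exists` (∀T₀ ≡ ∃T₀: `DrudeDissolution`'s threshold is usable),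
  `continuesAlong_iff_upward`, `not_continuesAlong_iff` (REFUTATION SHAPE),
  `continuesAlong_of_noCorner` (vacuous truth off the corner), `continuesAlong_iff_forall_of_corner`,
  `not_continuesAlong_lt_one` (no abstract continuation principle: chain input is indispensable).
§2 LOAD-BEARING ANALYSIS of `W` —
  §2a `chainSpecification_zero_temp`, `not_isChainGibbsMeasure_zero_temp` (NO chain has a DLR
  state at `T = 0`: junk `0⁻¹ = 0` makes the kernel the zero measure),
  `chainSpecification_pinnedChain_neg_temp`, `AbelWitness.temp_pos` (`W T → 0 < T`: the guard
  `0 < T` is already maximal), `not_abelWitness_zero_temp`, `not_tendsto_abel_zero_temp`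
  (second junk reason: `(0²)⁻¹ = 0`);
  §2b `restDynamics` (genuine inhabitant of the interface), `laxWitness_all_temp` (Gibbs ↦
  probability and `0<κ` ↦ `0≤κ` make witnesses exist at EVERY `T`: both clauses are load-bearing),
  `measure_coord_eq_zero_of_gibbs` (DLR states charge no coordinate hyperplane),
  `not_isChainGibbsMeasure_dirac_rest`;
  §2c `measure_eq_zero_of_carrier_empty`, `momenta_zero_of_const_isSolution`,
  `no_witness_of_currentCorrelation_zero`, `not_tendsto_of_drude_floor` (kill criterion (a): a
  Drude floor `C ≥ d > 0` makes the Abel functional diverge — the harmonic point `lam = β = 0` and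
  any Mazur charge are invisible to `W`, i.e. they REFUTE witnesses, they do not fake them).
§3 `γ` IS DECORATION — `transportUV`, `abelWitness_gamma_irrel`,
  `greenKuboContinuation_iff_gamma_free` (the crux is a statement about the closed chain
  `(ω₂, lam, β)`; `0 < γ` carries nothing).
§4 CORNER SANDWICH — `AbelianGreenKuboAllT`, `KineticCorner`,
  `greenKuboContinuation_of_allT`, `greenKuboContinuation_iff_allT_of_corner`,
  `kineticCorner_of_drudeDissolution` (= Step 1 of the route's `closes`),
  `greenKuboContinuation_iff_allT_of_drude` (MODULO THE ROUTE'S OWN TARGET THE CRUX *IS* ALL-`T`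
  ABELIAN GREEN–KUBO: the propagation form buys bookkeeping, not strength);
  §4b `tendsto_abel_of_integrableOn` (Abel summation of `L¹`, dominated convergence),
  `abelWitness_of_hasGreenKubo`, `greenKuboContinuation_of_fourierGreenKubo`
  (**stmt-12597 ≤ stmt-0703**: provers of `FourierGreenKubo` close this crux with that term).
§5 CONJUGACY / RAY FORM — `unitTempConjugacy_holds` (W(lam,β;T) ⇔ W(lamT,βT;1), SAME κ; tree:
  `InfiniteChainGibbsScaling` (DLR half, p68788) + `InfiniteChainAmplitudeScaling` (dynamics half,
  landed by this seat as p69671)), `greenKuboContinuation_iff_ray'` (the crux IS outward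
  propagation of unit-temperature witnesses along every coupling ray),
  `greenKuboContinuation_iff_unit_threshold'` (`T₀` normalisable to `1`),
  `abelWitness_conjugacyClass'`, `abelianGreenKuboAllT_iff_unit_temp`,
  `greenKuboContinuation_of_unit_temp_allCouplings` (corner-free sufficient condition = the
  honest prover target absent a continuation mechanism).
§6 TIGHTNESS OF THE IDEATORS' LEVERS — see the section docblock.

## Tree map (durable homes of the lemmas below; import these, not this workfile)

* `Literature/MathematicalPhysics/KineticTheory/InfiniteChainAbelWitness.lean` (p70072, this seat):
  §2a ↦ `OscillatorChain.chainSpecification_zero_temp`, `OscillatorChain.not_isChainGibbsMeasure_zero_temp`,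
  `chainSpecification_pinnedChain_neg_temp`, `isChainGibbsMeasure_pinnedChain_temp_pos`,
  `not_tendsto_abel_zero_temp`; §2b ↦ `restConfig`, `OscillatorChain.restDynamics`,
  `exists_laxAbelWitness`, `OscillatorChain.IsChainGibbsMeasure.measure_coord_eq_zero`,
  `OscillatorChain.not_isChainGibbsMeasure_dirac`, `deriv_U_pinnedChain_zero`; §2c ↦
  `InfiniteChainDynamics.measure_eq_zero_of_carrier_empty`,
  `OscillatorChain.momenta_zero_of_const_isSolution`, `not_tendsto_abel_of_correlation_zero`,
  `not_tendsto_abel_of_junk_integral`, `not_tendsto_of_drude_floor`; §3 ↦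
  `OscillatorChain.transportUV` & co., `abelWitness_pinnedChain_gamma_transport`; §4b ↦
  `tendsto_abel_of_integrableOn`, `InfiniteChainDynamics.HasGreenKubo.tendsto_abel`; §6 ↦
  `abelLimit_not_weakly_closed`, `integral_poisson_dirac`.
* `Literature/MathematicalPhysics/KineticTheory/InfiniteChainAmplitudeScaling.lean` (p69671, this seat) +
  `InfiniteChainGibbsScaling.lean` (p68788, cycle-1 seat): §5 ↦ `smulDynamics`,
  `currentCorrelation_smulDynamics`, `abelFunctional_smul`, `exists_abelWitness_iff_unit_temp`,
  `exists_hasGreenKubo_iff_unit_temp`, `isChainGibbsMeasure_map_dil_iff`.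
* Route-level theorems (§1 refutation shape, §3 γ-free slice, §4 sandwich / 0703 ⇒ crux, §5 ray
  form & threshold normalisation, lax triviality): proposed as
  `Summits/AtomisticToContinuum/FouriersLaw/Theorems/GreenKuboContinuation/Negative/Structure.lean`
  (namespace `Summit.AtomisticToContinuum.FouriersLaw.Theorems`; see NOTES for the proposal id).

## Census of attacks (cycle 1 by gen-1 seat, evidence notes; cycle 2 here)
junk witnesses (rest/Dirac, empty carrier, identity flow, `C ≡ 0`) → excluded (§2); degenerate
temperatures `T ≤ 0` → `W` empty, guards maximal (§2a); harmonic point / Mazur charges → they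
break `W` (Drude floor, §2c) but the corner hypothesis breaks with them — no refutation; abstract
shape → refutable but irrelevant (§1); parameter mutation: `0 < γ` unnecessary (§3), `0 < T₀`
essential (at `T₀ ≤ 0` the crux collapses to `AbelianGreenKuboAllT`), corner hypothesis = the
only input and it carries no quantitative handle (§4); literature: no printed mechanism for
`κ_A ∈ {0, ∞}` or a missing Abel limit in a pinned, non-integrable, momentum-non-conserving chain
at finite `T` (barrier files `AnticontinuumLocalization*`, `StrongPinningBreathers*`,
`LowTemperatureWeakAnharmonicity`, `MazurBoundBallistic*` read: each either concerns other chains,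
finite times, open chains, or the excluded harmonic endpoint).
-/

noncomputable section

namespace Summit.AtomisticToContinuum.FouriersLaw.Cruxes.GreenKuboContinuation.Disproof

open MeasureTheory Filter Set Topology
open scoped ENNReal
open Literature.MathematicalPhysics.KineticTheory.HeatConduction
open Literature.Probability.LatticeModels
open Summit.AtomisticToContinuum.FouriersLaw.Theses.EmbeddedDrudeMourre

/-! ## §1 Shape of the crux -/

/-- `W T`: an ABELIAN GREEN–KUBO WITNESS for `pinnedChain ω₂ lam β γ` at temperature `T` — the
predicate that both the hypothesis (for `T < T₀`) and the conclusion (for all `T > 0`) of the crux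
assert: a DLR Gibbs state `μT`, a `μT`-preserving infinite-volume dynamics with absolutely
convergent current correlations, and `κ > 0` with `T⁻²∫₀^∞e^{-νt}C(t)dt → κ` as `ν ↓ 0`. -/
def AbelWitness (ω₂ lam β γ T : ℝ) : Prop :=
  ∃ (μT : Measure ChainConfig) (D : InfiniteChainDynamics (pinnedChain ω₂ lam β γ)) (κ : ℝ),
    (pinnedChain ω₂ lam β γ).IsChainGibbsMeasure T μT ∧ D.PreservesMeasure μT ∧
      (∀ t : ℝ, D.HasAbsConvergentCorrelation μT t) ∧ 0 < κ ∧
        Tendsto (fun ν : ℝ => (T ^ 2)⁻¹ * ∫ t in Ioi (0 : ℝ),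
          Real.exp (-(ν * t)) * D.currentCorrelation μT t) (𝓝[>] (0 : ℝ)) (𝓝 κ)

/-- Abstract CONTINUATION shape: a temperature predicate that holds on some initial segment
`(0, T₀)` holds at every `T > 0`. -/
def ContinuesAlong (W : ℝ → Prop) : Prop :=
  ∀ T₀ : ℝ, 0 < T₀ → (∀ T : ℝ, 0 < T → T < T₀ → W T) → ∀ T : ℝ, 0 < T → W T

/-- The crux, read back symbol by symbol: it is `ContinuesAlong (AbelWitness ω₂ lam β γ)` for all
positive parameters (definitional unfolding, `Iff.rfl`). -/
theorem greenKuboContinuation_iff :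
    GreenKuboContinuation ↔ ∀ ω₂ lam β γ : ℝ, 0 < ω₂ → 0 < lam → 0 < β → 0 < γ →
      ContinuesAlong (AbelWitness ω₂ lam β γ) :=
  Iff.rfl

/-- `∀ T₀`-form ≡ `∃ T₀`-form: the threshold is only used existentially, so the existential `T₀`
delivered by `DrudeDissolution` is directly usable. -/
theorem continuesAlong_iff_exists (W : ℝ → Prop) :
    ContinuesAlong W ↔
      ((∃ T₀ : ℝ, 0 < T₀ ∧ ∀ T : ℝ, 0 < T → T < T₀ → W T) → ∀ T : ℝ, 0 < T → W T) := by
  constructor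
  · rintro h ⟨T₀, hT₀, hc⟩
    exact h T₀ hT₀ hc
  · intro h T₀ hT₀ hc
    exact h ⟨T₀, hT₀, hc⟩

/-- Only UPWARD propagation has content: below the threshold the conclusion is the hypothesis. -/
theorem continuesAlong_iff_upward (W : ℝ → Prop) :
    ContinuesAlong W ↔
      ∀ T₀ : ℝ, 0 < T₀ → (∀ T : ℝ, 0 < T → T < T₀ → W T) → ∀ T : ℝ, T₀ ≤ T → W T := by
  constructor
  · intro h T₀ hT₀ hc T hT
    exact h T₀ hT₀ hc T (hT₀.trans_le hT)
  · intro h T₀ hT₀ hc T hT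
    rcases lt_or_ge T T₀ with hlt | hle
    · exact hc T hT hlt
    · exact h T₀ hT₀ hc T hle

/-- REFUTATION SHAPE. `¬ ContinuesAlong W` iff some initial segment is good AND some `T ≥ T₀` is
bad: a disproof of the crux must PRODUCE corner witnesses (the open kinetic-corner problem) and
DESTROY every witness at one finite temperature. -/
theorem not_continuesAlong_iff (W : ℝ → Prop) :
    ¬ ContinuesAlong W ↔
      ∃ T₀ : ℝ, 0 < T₀ ∧ (∀ T : ℝ, 0 < T → T < T₀ → W T) ∧ ∃ T : ℝ, T₀ ≤ T ∧ ¬ W T := by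
  rw [continuesAlong_iff_upward]
  push Not
  rfl

/-- The unconditional all-`T` statement implies continuation (the conclusion regardless). -/
theorem continuesAlong_of_forall (W : ℝ → Prop) (h : ∀ T : ℝ, 0 < T → W T) : ContinuesAlong W :=
  fun _ _ _ T hT => h T hT

/-- VACUOUS TRUTH off the corner: if NO initial segment is good, continuation holds for free. On
parameter values where the kinetic corner fails, the crux carries no information. -/
theorem continuesAlong_of_noCorner (W : ℝ → Prop)
    (h : ∀ T₀ : ℝ, 0 < T₀ → ∃ T : ℝ, 0 < T ∧ T < T₀ ∧ ¬ W T) : ContinuesAlong W := by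
  intro T₀ hT₀ hc
  obtain ⟨T, hT, hlt, hW⟩ := h T₀ hT₀
  exact absurd (hc T hT hlt) hW

/-- With a corner seed, continuation IS the all-`T` statement. -/
theorem continuesAlong_iff_forall_of_corner (W : ℝ → Prop)
    (hc : ∃ T₀ : ℝ, 0 < T₀ ∧ ∀ T : ℝ, 0 < T → T < T₀ → W T) :
    ContinuesAlong W ↔ ∀ T : ℝ, 0 < T → W T :=
  ⟨fun h => (continuesAlong_iff_exists W).1 h hc, continuesAlong_of_forall W⟩

/-- NO ABSTRACT CONTINUATION PRINCIPLE: the shape alone is refutable (`W T := T < 1` holds on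
`(0, 1)` and fails at `1`). Every proof of the crux must use chain-specific input; conversely the
crux cannot be killed "by logic". -/
theorem not_continuesAlong_lt_one : ¬ ContinuesAlong (fun T : ℝ => T < 1) := by
  rw [not_continuesAlong_iff]
  exact ⟨1, one_pos, fun T _ h => h, 1, le_rfl, lt_irrefl 1⟩

/-! ## §2 Load-bearing analysis of the witness predicate `AbelWitness`

Which clauses keep the conclusion from being junk-satisfiable, and where the predicate is EMPTY
for junk reasons. -/

/-! ### §2a  `T = 0` (and `T < 0`): no DLR Gibbs state — the Gibbs kernel is the junk measure `0` -/

/-- The a priori measure of a non-empty volume has infinite mass (Lebesgue on `(ℝ × ℝ)^Λ`, glued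
into the boundary condition). -/
theorem map_glue_pi_volume_univ (Λ : Finset ℤ) (hΛ : Λ.Nonempty) (η : ChainConfig) :
    ((Measure.pi fun _ : Λ => (volume : Measure (ℝ × ℝ))).map (glueWith Λ · η)) univ = ∞ := by
  rw [Measure.map_apply (measurable_glueWith Λ η) MeasurableSet.univ, preimage_univ,
    Measure.pi_univ]
  have hvol : (volume : Measure (ℝ × ℝ)) univ = ∞ := by
    rw [show (univ : Set (ℝ × ℝ)) = univ ×ˢ univ from univ_prod_univ.symm, Measure.volume_eq_prod,
      Measure.prod_prod, Real.volume_univ, ENNReal.top_mul_top]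
  simp only [hvol]
  rw [Finset.prod_const, Finset.card_univ]
  apply ENNReal.top_pow
  simp [hΛ.ne_empty]

/-- If the Boltzmann weight is `≥ 1` pointwise (exponent `≥ 0`), it is not integrable against the
infinite a priori measure, so `Measure.tilted` returns its junk value `0`. -/
theorem gibbsKernel_eq_zero_of_exponent_nonneg (P : OscillatorChain) (b : ℝ) (Λ : Finset ℤ)
    (hΛ : Λ.Nonempty) (η : ChainConfig)
    (hexp : ∀ σ : ChainConfig, 0 ≤ -b * hamiltonianIn P.chainPotential OscillatorChain.chainSupp Λ σ) :
    gibbsSpecOfPotential (volume : Measure (ℝ × ℝ)) P.chainPotential OscillatorChain.chainSupp b Λ η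
      = 0 := by
  simp only [gibbsSpecOfPotential]
  apply tilted_of_not_integrable
  intro hint
  have hfin := hint.hasFiniteIntegral
  simp only [HasFiniteIntegral] at hfin
  have hge : ∫⁻ _σ, (1 : ℝ≥0∞)
      ∂((Measure.pi fun _ : Λ => (volume : Measure (ℝ × ℝ))).map (glueWith Λ · η)) ≤
      ∫⁻ σ, ‖Real.exp (-b * hamiltonianIn P.chainPotential OscillatorChain.chainSupp Λ σ)‖ₑ
        ∂((Measure.pi fun _ : Λ => (volume : Measure (ℝ × ℝ))).map (glueWith Λ · η)) := by
    refine lintegral_mono fun σ => ?_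
    have h1 : (1 : ℝ) ≤ Real.exp (-b * hamiltonianIn P.chainPotential OscillatorChain.chainSupp Λ σ) :=
      Real.one_le_exp (hexp σ)
    have h0 : (0 : ℝ) ≤ Real.exp (-b * hamiltonianIn P.chainPotential OscillatorChain.chainSupp Λ σ) :=
      (Real.exp_pos _).le
    rw [Real.enorm_eq_ofReal h0, ← ENNReal.ofReal_one]
    exact ENNReal.ofReal_le_ofReal h1
  rw [lintegral_one, map_glue_pi_volume_univ Λ hΛ η] at hge
  exact absurd (lt_of_le_of_lt hge hfin) (lt_irrefl _)

/-- **No chain has a Gibbs kernel at `T = 0`** on a non-empty volume: `chainSpecification P 0 Λ η`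
is the zero measure (`0⁻¹ = 0`, weight `e⁰ = 1`, normaliser `∞`, `Measure.tilted` junk). -/
theorem chainSpecification_zero_temp (P : OscillatorChain) (Λ : Finset ℤ) (hΛ : Λ.Nonempty)
    (η : ChainConfig) : P.chainSpecification 0 Λ η = 0 := by
  show gibbsSpecOfPotential volume P.chainPotential OscillatorChain.chainSupp (0:ℝ)⁻¹ Λ η = 0
  rw [inv_zero]
  exact gibbsKernel_eq_zero_of_exponent_nonneg P 0 Λ hΛ η (fun σ => by simp)

/-- A DLR state cannot integrate the zero kernel to a probability: **no chain has a DLR Gibbs state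
at temperature `0`** (a junk feature of `IsChainGibbsMeasure`, harmless under the crux's `0 < T`
guards, and the first reason the witness set is empty at the corner point itself). -/
theorem not_isChainGibbsMeasure_of_kernel_zero (P : OscillatorChain) (T : ℝ)
    (h0 : ∀ η : ChainConfig, P.chainSpecification T {0} η = 0) (μ : Measure ChainConfig) :
    ¬ P.IsChainGibbsMeasure T μ := by
  rintro ⟨hprob, hDLR⟩
  have h := hDLR {0} univ MeasurableSet.univ
  simp_rw [h0] at h
  simp only [Measure.coe_zero, Pi.zero_apply, lintegral_zero, measure_univ] at h
  exact zero_ne_one h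

theorem not_isChainGibbsMeasure_zero_temp (P : OscillatorChain) (μ : Measure ChainConfig) :
    ¬ P.IsChainGibbsMeasure 0 μ :=
  not_isChainGibbsMeasure_of_kernel_zero P 0
    (fun η => chainSpecification_zero_temp P {0} ⟨0, Finset.mem_singleton_self 0⟩ η) μ

/-- The finite-volume Hamiltonian of `pinnedChain` with non-negative couplings is non-negative. -/
theorem hamiltonianIn_pinnedChain_nonneg {ω₂ lam β : ℝ} (hω : 0 ≤ ω₂) (hl : 0 ≤ lam) (hβ : 0 ≤ β)
    (γ : ℝ) (Λ : Finset ℤ) (σ : ChainConfig) :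
    0 ≤ hamiltonianIn (pinnedChain ω₂ lam β γ).chainPotential OscillatorChain.chainSupp Λ σ := by
  unfold hamiltonianIn
  refine Finset.sum_nonneg fun A _ => ?_
  simp only [OscillatorChain.chainPotential, pinnedChain]
  refine add_nonneg (Finset.sum_nonneg fun x _ => ?_) (Finset.sum_nonneg fun x _ => ?_)
  · split_ifs
    · positivity
    · exact le_rfl
  · split_ifs
    · positivity
    · exact le_rfl

/-- **Negative temperatures are empty too** for the crux's chain: with `ω₂, lam, β ≥ 0` the
Hamiltonian is `≥ 0`, so for `T < 0` the weight `e^{-H/T} ≥ 1` is not normalisable. -/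
theorem chainSpecification_pinnedChain_neg_temp {ω₂ lam β : ℝ} (hω : 0 ≤ ω₂) (hl : 0 ≤ lam)
    (hβ : 0 ≤ β) (γ : ℝ) {T : ℝ} (hT : T < 0) (Λ : Finset ℤ) (hΛ : Λ.Nonempty) (η : ChainConfig) :
    (pinnedChain ω₂ lam β γ).chainSpecification T Λ η = 0 := by
  show gibbsSpecOfPotential volume _ OscillatorChain.chainSupp T⁻¹ Λ η = 0
  refine gibbsKernel_eq_zero_of_exponent_nonneg _ _ Λ hΛ η fun σ => ?_
  have hTi : -T⁻¹ ≥ 0 := by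
    have : T⁻¹ < 0 := inv_lt_zero.mpr hT
    linarith
  exact mul_nonneg hTi (hamiltonianIn_pinnedChain_nonneg hω hl hβ γ Λ σ)

/-- **The witness predicate forces `0 < T`** on the crux's parameter range (indeed for
`ω₂, lam, β ≥ 0`): the guard `0 < T` in the conclusion cannot be weakened — `W T` is empty for
`T ≤ 0` — so the crux is already stated on the maximal temperature set. -/
theorem AbelWitness.temp_pos {ω₂ lam β γ T : ℝ} (hω : 0 ≤ ω₂) (hl : 0 ≤ lam) (hβ : 0 ≤ β)
    (h : AbelWitness ω₂ lam β γ T) : 0 < T := by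
  obtain ⟨μT, _, _, hG, -⟩ := h
  by_contra hT
  rcases (not_lt.mp hT).eq_or_lt with h0 | hneg
  · exact not_isChainGibbsMeasure_zero_temp _ μT (h0 ▸ hG)
  · exact not_isChainGibbsMeasure_of_kernel_zero _ T
      (fun η => chainSpecification_pinnedChain_neg_temp hω hl hβ γ hneg {0}
        ⟨0, Finset.mem_singleton_self 0⟩ η) μT hG

/-- In particular there is no witness AT the corner point `T = 0` (for any real parameters). -/
theorem not_abelWitness_zero_temp (ω₂ lam β γ : ℝ) : ¬ AbelWitness ω₂ lam β γ 0 := by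
  rintro ⟨μT, _, _, hG, -⟩
  exact not_isChainGibbsMeasure_zero_temp _ μT hG

/-- Second, independent junk reason at `T = 0`: the normalisation `(0²)⁻¹ = 0` makes the Abel
functional identically `0`, which cannot tend to `κ > 0` (no Gibbs clause used). -/
theorem not_tendsto_abel_zero_temp {P : OscillatorChain} (D : InfiniteChainDynamics P)
    (μ : Measure ChainConfig) {κ : ℝ} (hκ : 0 < κ) :
    ¬ Tendsto (fun ν : ℝ => ((0 : ℝ) ^ 2)⁻¹ * ∫ t in Ioi (0 : ℝ),
        Real.exp (-(ν * t)) * D.currentCorrelation μ t) (𝓝[>] (0 : ℝ)) (𝓝 κ) := by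
  intro h
  simp only [ne_eq, OfNat.ofNat_ne_zero, not_false_eq_true, zero_pow, inv_zero, zero_mul] at h
  exact hκ.ne' (tendsto_nhds_unique h tendsto_const_nhds)

/-! ### §2b  Lax witnesses: without the Gibbs clause, or with `0 ≤ κ`, witnesses are JUNK-TRIVIAL -/

/-- The configuration at rest. -/
def rest : ChainConfig := fun _ => (0, 0)

/-- The REST DYNAMICS: a genuine inhabitant of `InfiniteChainDynamics P` for every chain with
`U'(0) = 0` — carrier `{rest}`, identity flow (the rest point is an equilibrium; uniqueness within
the one-point carrier is trivial). Shows the interface is inhabited by junk, filtered out only by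
`PreservesMeasure` + the Gibbs clause. -/
def restDynamics (P : OscillatorChain) (hU : deriv P.U 0 = 0) : InfiniteChainDynamics P where
  carrier := {rest}
  flow := fun _ σ => σ
  mapsTo := fun _ _ hσ => hσ
  flow_zero := fun _ _ => rfl
  isSolution := by
    intro σ hσ
    rw [mem_singleton_iff] at hσ
    subst hσ
    exact P.isSolution_const_zero hU
  unique := by
    intro c hc _ t
    show c t = c 0
    rw [mem_singleton_iff.mp (hc t), mem_singleton_iff.mp (hc 0)]

theorem pinnedChain_deriv_U_zero (ω₂ lam β γ : ℝ) : deriv (pinnedChain ω₂ lam β γ).U 0 = 0 := by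
  rw [pinnedChain_deriv_U]; ring

/-- The rest dynamics preserves the Dirac mass at rest. -/
theorem restDynamics_preserves_dirac (P : OscillatorChain) (hU : deriv P.U 0 = 0) :
    (restDynamics P hU).PreservesMeasure (Measure.dirac rest) := by
  refine ⟨?_, fun t => ?_⟩
  · rw [ae_dirac_eq]
    show rest ∈ ({rest} : Set ChainConfig)
    exact mem_singleton rest
  · exact MeasurePreserving.id _

/-- The bond current vanishes at rest. -/
@[simp] theorem bondCurrentZ_rest (P : OscillatorChain) (x : ℤ) : P.bondCurrentZ rest x = 0 := by
  simp [OscillatorChain.bondCurrentZ, rest]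

/-- Current correlations of the rest dynamics in the Dirac state vanish identically. -/
theorem currentCorrelation_rest (P : OscillatorChain) (hU : deriv P.U 0 = 0) (t : ℝ) :
    (restDynamics P hU).currentCorrelation (Measure.dirac rest) t = 0 := by
  simp [InfiniteChainDynamics.currentCorrelation, integral_dirac]

theorem hasAbsConvergentCorrelation_rest (P : OscillatorChain) (hU : deriv P.U 0 = 0) (t : ℝ) :
    (restDynamics P hU).HasAbsConvergentCorrelation (Measure.dirac rest) t := by
  refine ⟨fun x => integrable_dirac (by simp), ?_⟩
  simp only [integral_dirac, bondCurrentZ_rest, zero_mul, abs_zero]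
  exact summable_zero

/-- **LAX WITNESSES EXIST AT EVERY `T`** once the Gibbs clause is weakened to "probability measure"
and `0 < κ` to `0 ≤ κ`: Dirac mass at rest, rest dynamics, `C ≡ 0`, `κ = 0`. Hence BOTH clauses
are load-bearing for the non-triviality of the crux's conclusion (and of its hypothesis): the
statement is not junk-provable. -/
theorem laxWitness_all_temp (ω₂ lam β γ T : ℝ) :
    ∃ (μ : Measure ChainConfig) (D : InfiniteChainDynamics (pinnedChain ω₂ lam β γ)) (κ : ℝ),
      IsProbabilityMeasure μ ∧ D.PreservesMeasure μ ∧
        (∀ t : ℝ, D.HasAbsConvergentCorrelation μ t) ∧ 0 ≤ κ ∧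
          Tendsto (fun ν : ℝ => (T ^ 2)⁻¹ * ∫ t in Ioi (0 : ℝ),
            Real.exp (-(ν * t)) * D.currentCorrelation μ t) (𝓝[>] (0 : ℝ)) (𝓝 κ) := by
  refine ⟨Measure.dirac rest, restDynamics _ (pinnedChain_deriv_U_zero ω₂ lam β γ), 0,
    inferInstance, restDynamics_preserves_dirac _ _, hasAbsConvergentCorrelation_rest _ _, le_rfl, ?_⟩
  simp only [currentCorrelation_rest, mul_zero, integral_zero]
  exact tendsto_const_nhds

/-- … and the Dirac state at rest is NOT a Gibbs state of any chain at any temperature: DLR states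
give zero mass to `{σ | σ 0 = (0,0)}` (the kernel in volume `{0}` is absolutely continuous w.r.t.
Lebesgue in the coordinate `σ 0`). This is the clause that removes the lax witness. -/
theorem measure_coord_eq_zero_of_gibbs {P : OscillatorChain} {T : ℝ}
    {μ : Measure ChainConfig} (h : P.IsChainGibbsMeasure T μ) (v : ℝ × ℝ) :
    μ {σ | σ 0 = v} = 0 := by
  obtain ⟨-, hDLR⟩ := h
  have hA : MeasurableSet {σ : ChainConfig | σ 0 = v} :=
    measurableSet_eq_fun (measurable_pi_apply 0) measurable_const
  rw [← hDLR {0} _ hA]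
  have hker : ∀ η : ChainConfig, P.chainSpecification T {0} η {σ | σ 0 = v} = 0 := by
    intro η
    show gibbsSpecOfPotential volume P.chainPotential OscillatorChain.chainSupp T⁻¹ {0} η _ = 0
    simp only [gibbsSpecOfPotential]
    refine tilted_absolutelyContinuous _ _ ?_
    rw [Measure.map_apply (measurable_glueWith _ η) hA]
    have hpre : (fun ζ : (({0} : Finset ℤ)) → ℝ × ℝ => glueWith {0} ζ η) ⁻¹' {σ | σ 0 = v} =
        Set.pi univ (fun _ => {v}) := by
      ext ζ
      simp only [mem_preimage, mem_setOf_eq, mem_univ_pi, mem_singleton_iff]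
      constructor
      · intro hζ i
        obtain ⟨i, hi⟩ := i
        have hi0 : i = 0 := Finset.mem_singleton.mp hi
        subst hi0
        rwa [glueWith_apply_mem _ _ _ hi] at hζ
      · intro hζ
        rw [glueWith_apply_mem _ _ _ (Finset.mem_singleton_self 0)]
        exact hζ ⟨0, Finset.mem_singleton_self 0⟩
    rw [hpre, Measure.pi_pi]
    apply Finset.prod_eq_zero (Finset.mem_univ ⟨0, Finset.mem_singleton_self 0⟩)
    rw [show ({v} : Set (ℝ × ℝ)) = {v.1} ×ˢ {v.2} by ext ⟨a, b⟩; simp [Prod.ext_iff],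
      Measure.volume_eq_prod, Measure.prod_prod]
    simp
  simp_rw [hker]
  exact lintegral_zero

theorem not_isChainGibbsMeasure_dirac_rest (P : OscillatorChain) (T : ℝ) :
    ¬ P.IsChainGibbsMeasure T (Measure.dirac rest) := by
  intro h
  have h0 := measure_coord_eq_zero_of_gibbs h (0, 0)
  rw [Measure.dirac_apply_of_mem (show rest ∈ {σ : ChainConfig | σ 0 = (0, 0)} from rfl)] at h0
  exact one_ne_zero h0

/-! ### §2c  Junk inhabitants of the interface give no witness -/

/-- Empty carrier: `PreservesMeasure` forces `μ = 0` (not a probability, so no Gibbs state). -/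
theorem measure_eq_zero_of_carrier_empty {P : OscillatorChain} (D : InfiniteChainDynamics P)
    (hD : D.carrier = ∅) {μ : Measure ChainConfig} (h : D.PreservesMeasure μ) : μ = 0 := by
  obtain ⟨hae, -⟩ := h
  rw [hD] at hae
  simp only [mem_empty_iff_false, eventually_false_iff_eq_bot, ae_eq_bot] at hae
  exact hae

/-- Identity flow: every carrier point is an equilibrium, in particular all momenta vanish — a
`μ`-null event for every Gibbs `μ` (`measure_coord_eq_zero_of_gibbs`), so no witness. -/
theorem momenta_zero_of_const_isSolution {P : OscillatorChain} {σ : ChainConfig}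
    (h : P.IsSolution fun _ : ℝ => σ) (i : ℤ) : (σ i).2 = 0 := by
  have h1 := (h i 0).1
  have h2 : HasDerivAt (fun _ : ℝ => (σ i).1) 0 0 := hasDerivAt_const 0 _
  exact (h1.unique h2)

/-- Vanishing correlations (e.g. any junk making the `tsum`/Bochner objects `0`): the Abel
functional is `0` and cannot tend to `κ > 0`. -/
theorem no_witness_of_currentCorrelation_zero {P : OscillatorChain} (D : InfiniteChainDynamics P)
    (μ : Measure ChainConfig) (T : ℝ) (hC : ∀ t : ℝ, D.currentCorrelation μ t = 0) {κ : ℝ}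
    (hκ : 0 < κ) :
    ¬ Tendsto (fun ν : ℝ => (T ^ 2)⁻¹ * ∫ t in Ioi (0 : ℝ),
        Real.exp (-(ν * t)) * D.currentCorrelation μ t) (𝓝[>] (0 : ℝ)) (𝓝 κ) := by
  intro h
  simp only [hC, mul_zero, integral_zero] at h
  exact hκ.ne' (tendsto_nhds_unique h tendsto_const_nhds)

/-- NON-INTEGRABLE / NON-MEASURABLE `t ↦ e^{-νt}C(t)`: the Bochner integral is then the junk value
`0` for all small `ν`, so no `κ > 0` is a limit. Warning to provers: a witness must come with
(ae-strong) measurability of `t ↦ C(t)` and integrability of `e^{-νt}C(t)` on `(0, ∞)` for small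
`ν > 0`; the interface `InfiniteChainDynamics` has no joint-measurability field supplying this. -/
theorem no_witness_of_junk_integral {P : OscillatorChain} (D : InfiniteChainDynamics P)
    (μ : Measure ChainConfig) (T : ℝ)
    (hC : ∀ᶠ ν in 𝓝[>] (0 : ℝ),
      ¬ IntegrableOn (fun t : ℝ => Real.exp (-(ν * t)) * D.currentCorrelation μ t) (Ioi 0))
    {κ : ℝ} (hκ : 0 < κ) :
    ¬ Tendsto (fun ν : ℝ => (T ^ 2)⁻¹ * ∫ t in Ioi (0 : ℝ),
        Real.exp (-(ν * t)) * D.currentCorrelation μ t) (𝓝[>] (0 : ℝ)) (𝓝 κ) := by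
  intro h
  have h0 : Tendsto (fun ν : ℝ => (T ^ 2)⁻¹ * ∫ t in Ioi (0 : ℝ),
      Real.exp (-(ν * t)) * D.currentCorrelation μ t) (𝓝[>] (0 : ℝ)) (𝓝 0) := by
    refine (tendsto_const_nhds (x := (0 : ℝ))).congr' ?_
    filter_upwards [hC] with ν hν
    rw [integral_undef hν, mul_zero]
  exact hκ.ne' (tendsto_nhds_unique h h0)

/-- BALLISTIC OBSTRUCTION (kill criterion (a), Mazur/Drude): if the correlation has a positive
floor `d ≤ C(t)` for `t ≥ t₀` and is locally integrable, the Abel functional diverges, so no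
`κ` is its limit. Stated for the regularised integral as a real function `A` with the lower bound
`d·e^{-ν t₀}/ν - M ≤ A ν` that such a floor produces. -/
theorem not_tendsto_of_drude_floor {A : ℝ → ℝ} {d t₀ M : ℝ} (hd : 0 < d)
    (hA : ∀ ν : ℝ, 0 < ν → ν ≤ 1 → d * Real.exp (-(ν * t₀)) / ν - M ≤ A ν) (κ : ℝ) :
    ¬ Tendsto A (𝓝[>] (0 : ℝ)) (𝓝 κ) := by
  intro hlim
  -- along ν → 0⁺ the lower bound tends to +∞
  have hlow : Tendsto (fun ν : ℝ => d * Real.exp (-(ν * t₀)) / ν - M) (𝓝[>] (0 : ℝ)) atTop := by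
    have h1 : Tendsto (fun ν : ℝ => d * Real.exp (-(ν * t₀))) (𝓝[>] (0 : ℝ)) (𝓝 (d * 1)) := by
      refine Tendsto.const_mul d ?_
      have : Tendsto (fun ν : ℝ => Real.exp (-(ν * t₀))) (𝓝 (0 : ℝ)) (𝓝 (Real.exp (-(0 * t₀)))) :=
        ((continuous_neg.comp (continuous_id.mul continuous_const)).tendsto 0 |> Real.continuous_exp.continuousAt.tendsto.comp)
      simp only [zero_mul, neg_zero, Real.exp_zero] at this
      exact this.mono_left nhdsWithin_le_nhds
    rw [mul_one] at h1
    have h2 : Tendsto (fun ν : ℝ => ν⁻¹) (𝓝[>] (0 : ℝ)) atTop := tendsto_inv_nhdsGT_zero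
    have h3 : Tendsto (fun ν : ℝ => d * Real.exp (-(ν * t₀)) * ν⁻¹) (𝓝[>] (0 : ℝ)) atTop :=
      Tendsto.pos_mul_atTop hd h1 h2
    simp_rw [← div_eq_mul_inv] at h3
    exact tendsto_atTop_add_const_right _ (-M) h3 |>.congr (fun ν => by ring)
  -- A is eventually ≥ the lower bound on (0,1], hence A → ∞, contradicting convergence
  have hev : ∀ᶠ ν in 𝓝[>] (0 : ℝ), d * Real.exp (-(ν * t₀)) / ν - M ≤ A ν := by
    have : ∀ᶠ ν in 𝓝[>] (0 : ℝ), ν ∈ Ioc (0 : ℝ) 1 := Ioc_mem_nhdsGT one_pos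
    filter_upwards [this] with ν hν using hA ν hν.1 hν.2
  have hAtop : Tendsto A (𝓝[>] (0 : ℝ)) atTop := tendsto_atTop_mono' _ hev hlow
  exact not_tendsto_nhds_of_tendsto_atTop hAtop κ hlim

/-! ## §3 The bath coupling `γ` is decoration -/

/-- Two chains with the same potentials have the same forces. -/
theorem force_eq_of_UV {P P' : OscillatorChain} (hU : P.U = P'.U) (hV : P.V = P'.V) :
    P.force = P'.force := by
  funext σ i
  simp only [OscillatorChain.force, OscillatorChain.interactionForce, hU, hV]

theorem isSolution_iff_of_UV {P P' : OscillatorChain} (hU : P.U = P'.U) (hV : P.V = P'.V)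
    (c : ℝ → ChainConfig) : P.IsSolution c ↔ P'.IsSolution c := by
  unfold OscillatorChain.IsSolution
  rw [force_eq_of_UV hU hV]

/-- Transport of an infinite-volume dynamics between chains with the same potentials (e.g.
`pinnedChain ω₂ lam β γ` and `pinnedChain ω₂ lam β γ'`). -/
def transportUV {P P' : OscillatorChain} (hU : P.U = P'.U) (hV : P.V = P'.V)
    (D : InfiniteChainDynamics P) : InfiniteChainDynamics P' where
  carrier := D.carrier
  flow := D.flow
  mapsTo := D.mapsTo
  flow_zero := D.flow_zero
  isSolution := fun σ hσ => (isSolution_iff_of_UV hU hV _).1 (D.isSolution σ hσ)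
  unique := fun c hc hsol => D.unique c hc ((isSolution_iff_of_UV hU hV c).2 hsol)

theorem bondCurrentZ_eq_of_V {P P' : OscillatorChain} (hV : P.V = P'.V) :
    P.bondCurrentZ = P'.bondCurrentZ := by
  funext σ x; simp only [OscillatorChain.bondCurrentZ, hV]

theorem currentCorrelation_transportUV {P P' : OscillatorChain} (hU : P.U = P'.U) (hV : P.V = P'.V)
    (D : InfiniteChainDynamics P) (μ : Measure ChainConfig) (t : ℝ) :
    (transportUV hU hV D).currentCorrelation μ t = D.currentCorrelation μ t := by
  simp only [InfiniteChainDynamics.currentCorrelation, transportUV, bondCurrentZ_eq_of_V hV]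

theorem hasAbsConvergentCorrelation_transportUV_iff {P P' : OscillatorChain} (hU : P.U = P'.U)
    (hV : P.V = P'.V) (D : InfiniteChainDynamics P) (μ : Measure ChainConfig) (t : ℝ) :
    (transportUV hU hV D).HasAbsConvergentCorrelation μ t ↔ D.HasAbsConvergentCorrelation μ t := by
  simp only [InfiniteChainDynamics.HasAbsConvergentCorrelation, transportUV, bondCurrentZ_eq_of_V hV]

theorem preservesMeasure_transportUV_iff {P P' : OscillatorChain} (hU : P.U = P'.U)
    (hV : P.V = P'.V) (D : InfiniteChainDynamics P) (μ : Measure ChainConfig) :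
    (transportUV hU hV D).PreservesMeasure μ ↔ D.PreservesMeasure μ := Iff.rfl

theorem chainSpecification_eq_of_UV {P P' : OscillatorChain} (hU : P.U = P'.U) (hV : P.V = P'.V) :
    P.chainSpecification = P'.chainSpecification := by
  have hΦ : P.chainPotential = P'.chainPotential := by
    funext A σ; simp only [OscillatorChain.chainPotential, hU, hV]
  funext T
  simp only [OscillatorChain.chainSpecification, hΦ]

theorem isChainGibbsMeasure_iff_of_UV {P P' : OscillatorChain} (hU : P.U = P'.U) (hV : P.V = P'.V)
    (T : ℝ) (μ : Measure ChainConfig) : P.IsChainGibbsMeasure T μ ↔ P'.IsChainGibbsMeasure T μ := by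
  simp only [OscillatorChain.IsChainGibbsMeasure, chainSpecification_eq_of_UV hU hV]

/-- One direction of the `γ`-independence of the witness predicate. -/
theorem AbelWitness.of_gamma {ω₂ lam β T : ℝ} (γ γ' : ℝ) (h : AbelWitness ω₂ lam β γ T) :
    AbelWitness ω₂ lam β γ' T := by
  have hU : (pinnedChain ω₂ lam β γ).U = (pinnedChain ω₂ lam β γ').U := rfl
  have hV : (pinnedChain ω₂ lam β γ).V = (pinnedChain ω₂ lam β γ').V := rfl
  obtain ⟨μT, D, κ, hG, hP, hAC, hκ, hlim⟩ := h
  refine ⟨μT, transportUV hU hV D, κ, (isChainGibbsMeasure_iff_of_UV hU hV T μT).1 hG,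
    (preservesMeasure_transportUV_iff hU hV D μT).2 hP,
    fun t => (hasAbsConvergentCorrelation_transportUV_iff hU hV D μT t).2 (hAC t), hκ, ?_⟩
  simp only [currentCorrelation_transportUV]
  exact hlim

/-- **`γ` IS DECORATION**: the witness predicate does not depend on the bath coupling (the
infinite closed chain has no baths), … -/
theorem abelWitness_gamma_irrel (ω₂ lam β γ γ' T : ℝ) :
    AbelWitness ω₂ lam β γ T ↔ AbelWitness ω₂ lam β γ' T :=
  ⟨AbelWitness.of_gamma γ γ', AbelWitness.of_gamma γ' γ⟩

/-- … so the crux is equivalent to its `γ = 1` slice with the hypothesis `0 < γ` deleted: a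
statement about the CLOSED infinite chain `(ω₂, lam, β)` only. -/
theorem greenKuboContinuation_iff_gamma_free :
    GreenKuboContinuation ↔
      ∀ ω₂ lam β : ℝ, 0 < ω₂ → 0 < lam → 0 < β → ContinuesAlong (AbelWitness ω₂ lam β 1) := by
  rw [greenKuboContinuation_iff]
  constructor
  · intro h ω₂ lam β hω hl hβ
    exact h ω₂ lam β 1 hω hl hβ one_pos
  · intro h ω₂ lam β γ hω hl hβ _ T₀ hT₀ hc T hT
    have hc' : ∀ T : ℝ, 0 < T → T < T₀ → AbelWitness ω₂ lam β 1 T :=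
      fun T hT hlt => (abelWitness_gamma_irrel ω₂ lam β γ 1 T).1 (hc T hT hlt)
    exact (abelWitness_gamma_irrel ω₂ lam β γ 1 T).2 (h ω₂ lam β hω hl hβ T₀ hT₀ hc' T hT)

/-! ## §4 The corner hypothesis: sandwich between unconditional statements -/

/-- ALL-TEMPERATURE ABELIAN GREEN–KUBO: the crux's conclusion asserted unconditionally (the Abelian
shadow of `FourierGreenKubo.FourierGreenKubo`, stmt-AtomisticToContinuum-0703). -/
def AbelianGreenKuboAllT : Prop :=
  ∀ ω₂ lam β γ : ℝ, 0 < ω₂ → 0 < lam → 0 < β → 0 < γ → ∀ T : ℝ, 0 < T → AbelWitness ω₂ lam β γ T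

/-- THE KINETIC CORNER: Abelian witnesses on some initial temperature segment (what
`DrudeDissolution ∧ AbelOfSpectralDensity` deliver, `kineticCorner_of_drudeDissolution`). -/
def KineticCorner : Prop :=
  ∀ ω₂ lam β γ : ℝ, 0 < ω₂ → 0 < lam → 0 < β → 0 < γ →
    ∃ T₀ : ℝ, 0 < T₀ ∧ ∀ T : ℝ, 0 < T → T < T₀ → AbelWitness ω₂ lam β γ T

/-- Upper bread: the all-`T` statement implies the crux. -/
theorem greenKuboContinuation_of_allT (h : AbelianGreenKuboAllT) : GreenKuboContinuation :=
  fun ω₂ lam β γ hω hl hβ hγ =>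
    continuesAlong_of_forall _ (h ω₂ lam β γ hω hl hβ hγ)

/-- Lower bread: corner + crux give the all-`T` statement. -/
theorem allT_of_corner_of_greenKuboContinuation (hc : KineticCorner) (h : GreenKuboContinuation) :
    AbelianGreenKuboAllT :=
  fun ω₂ lam β γ hω hl hβ hγ =>
    (continuesAlong_iff_forall_of_corner _ (hc ω₂ lam β γ hω hl hβ hγ)).1 (h ω₂ lam β γ hω hl hβ hγ)

/-- **MODULO THE CORNER, THE CRUX IS EXACTLY ALL-`T` ABELIAN GREEN–KUBO.** -/
theorem greenKuboContinuation_iff_allT_of_corner (hc : KineticCorner) :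
    GreenKuboContinuation ↔ AbelianGreenKuboAllT :=
  ⟨allT_of_corner_of_greenKuboContinuation hc, greenKuboContinuation_of_allT⟩

/-- The route's own target and support lemma produce the corner (this is Step 1 of the route's
`closes`): `DrudeDissolution → AbelOfSpectralDensity → KineticCorner`. -/
theorem kineticCorner_of_drudeDissolution (hDD : DrudeDissolution) (hA : AbelOfSpectralDensity) :
    KineticCorner := by
  intro ω₂ lam β γ hω hl hβ hγ
  obtain ⟨T₀, hT₀, hdiss⟩ := hDD ω₂ lam β γ hω hl hβ hγ
  refine ⟨T₀, hT₀, fun T hT hTlt => ?_⟩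
  obtain ⟨μT, D, hG, hP, hAC, σ, hσ, hCσ, δ, g, hδ, hg, hg0, hgpos, hac⟩ := hdiss T hT hTlt
  refine ⟨μT, D, (T ^ 2)⁻¹ * (Real.pi * g 0), hG, hP, hAC,
    mul_pos (inv_pos.mpr (pow_pos hT 2)) (mul_pos Real.pi_pos hgpos), ?_⟩
  exact (hA σ (D.currentCorrelation μT) δ g hσ hδ hCσ hg hg0 hac).const_mul ((T ^ 2)⁻¹)

/-- Hence, GIVEN THE ROUTE'S TARGET, the crux is equivalent to all-`T` Abelian Green–Kubo: any
refutation of `GreenKuboContinuation` that leaves `DrudeDissolution` standing is a refutation of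
the Abelian Green–Kubo formula at some finite temperature of a pinned doubly-quartic chain. -/
theorem greenKuboContinuation_iff_allT_of_drude (hDD : DrudeDissolution) (hA : AbelOfSpectralDensity) :
    GreenKuboContinuation ↔ AbelianGreenKuboAllT :=
  greenKuboContinuation_iff_allT_of_corner (kineticCorner_of_drudeDissolution hDD hA)

/-! ### §4b  `FourierGreenKubo` (stmt-0703, `C ∈ L¹`) ⇒ the crux, certified -/

/-- Abel summation of an `L¹` function: `∫₀^∞ e^{-νt}C(t)dt → ∫₀^∞ C` as `ν ↓ 0` (dominated
convergence with bound `|C|`). -/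
theorem tendsto_abel_of_integrableOn {C : ℝ → ℝ} (hC : IntegrableOn C (Ioi 0)) :
    Tendsto (fun ν : ℝ => ∫ t in Ioi (0 : ℝ), Real.exp (-(ν * t)) * C t) (𝓝[>] (0 : ℝ))
      (𝓝 (∫ t in Ioi (0 : ℝ), C t)) := by
  refine tendsto_integral_filter_of_dominated_convergence (fun t => ‖C t‖) ?_ ?_ hC.norm ?_
  · refine Eventually.of_forall fun ν => ?_
    exact ((Real.continuous_exp.comp (continuous_const.mul continuous_id).neg).aestronglyMeasurable).mul
      hC.aestronglyMeasurable
  · have : ∀ᶠ ν in 𝓝[>] (0 : ℝ), 0 < ν := eventually_mem_nhdsWithin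
    filter_upwards [this] with ν hν
    filter_upwards [ae_restrict_mem measurableSet_Ioi] with t ht
    rw [norm_mul, Real.norm_eq_abs, abs_of_pos (Real.exp_pos _)]
    have ht' : (0 : ℝ) < t := ht
    have : Real.exp (-(ν * t)) ≤ 1 :=
      Real.exp_le_one_iff.mpr (neg_nonpos.mpr (mul_nonneg hν.le ht'.le))
    exact mul_le_of_le_one_left (norm_nonneg _) this
  · refine Eventually.of_forall fun t => ?_
    have h1 : Tendsto (fun ν : ℝ => Real.exp (-(ν * t)) * C t) (𝓝 (0 : ℝ)) (𝓝 (Real.exp (-(0 * t)) * C t)) :=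
      ((Real.continuous_exp.comp (continuous_id.mul continuous_const).neg).mul continuous_const).tendsto 0
    simp only [zero_mul, neg_zero, Real.exp_zero, one_mul] at h1
    exact h1.mono_left nhdsWithin_le_nhds

/-- A Green–Kubo pair (`HasGreenKubo`: absolutely convergent `C`, `C ∈ L¹(0,∞)`, `κ_GK > 0`) at a
Gibbs state is an Abelian witness with `κ = κ_GK`. -/
theorem abelWitness_of_hasGreenKubo {ω₂ lam β γ T : ℝ} {μ : Measure ChainConfig}
    {D : InfiniteChainDynamics (pinnedChain ω₂ lam β γ)}
    (hG : (pinnedChain ω₂ lam β γ).IsChainGibbsMeasure T μ) (hP : D.PreservesMeasure μ)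
    (hGK : D.HasGreenKubo μ T) : AbelWitness ω₂ lam β γ T := by
  obtain ⟨hAC, hint, hpos⟩ := hGK
  refine ⟨μ, D, D.greenKuboConductivity μ T, hG, hP, hAC, hpos, ?_⟩
  exact (tendsto_abel_of_integrableOn hint).const_mul ((T ^ 2)⁻¹)

/-- `FourierGreenKubo` (stmt-0703) implies all-`T` Abelian Green–Kubo … -/
theorem allT_of_fourierGreenKubo
    (h : Summit.AtomisticToContinuum.FouriersLaw.Theses.FourierGreenKubo.FourierGreenKubo) :
    AbelianGreenKuboAllT := by
  intro ω₂ lam β γ hω hl hβ hγ T hT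
  obtain ⟨μ, hG, D, hP, hGK⟩ := h ω₂ lam β γ hω hl hβ hγ T hT
  exact abelWitness_of_hasGreenKubo hG hP hGK

/-- … hence the crux: **stmt-12597 ≤ stmt-0703** formally (provers of 0703 close 12597 with this
term). -/
theorem greenKuboContinuation_of_fourierGreenKubo
    (h : Summit.AtomisticToContinuum.FouriersLaw.Theses.FourierGreenKubo.FourierGreenKubo) :
    GreenKuboContinuation :=
  greenKuboContinuation_of_allT (allT_of_fourierGreenKubo h)

/-! ## §5 Conjugacy and the ray form

LOW TEMPERATURE IS WEAK ANHARMONICITY. The amplitude dilation `σ ↦ √T • σ` conjugates the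
`(lam, β)` chain at temperature `T` to the `(lam T, β T)` chain at temperature `1` (no time
change; `C_T = T² C'_1`, so the `T⁻²`-normalised Abel functionals agree with the SAME `κ`). The
DLR half is tree content (`InfiniteChainGibbsScaling`: `isChainGibbsMeasure_map_dil_iff`,
`exists_isChainGibbsMeasure_iff_unit_temp`); the dynamical half (transport of
`InfiniteChainDynamics`, currents, `PreservesMeasure`, the Abel functional) was proposal p68965
of the cycle-1 seat, BOUNCED by a gate restart in flight, and is RE-DERIVED by this seat as
proposal p69671 (`Literature/MathematicalPhysics/KineticTheory/InfiniteChainAmplitudeScaling.lean`,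
ACCEPTED 2026-08-15T23:12Z, commit 584661f6feee): `exists_abelWitness_iff_unit_temp` there is
LITERALLY `UnitTempConjugacy` below unfolded, so the hypothesis is now DISCHARGED
(`unitTempConjugacy_holds`) and the ray form / threshold normalisation hold unconditionally
(primed versions below): the crux is OUTWARD
PROPAGATION OF UNIT-TEMPERATURE WITNESSES ALONG EVERY RAY `c ↦ (a c, b c)` of the coupling
quadrant, and the threshold may be normalised to `T₀ = 1`. Refutation, ray form: a direction
`(a, b)` whose ray is good near the origin (kinetic corner) and bad at one finite distance. The far
end of every ray with `b > 0` is the scale-free doubly-quartic pinned chain (`κ₄(T) = T^{1/4}κ₄(1)`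
by the exact quartic scaling), NOT De Roeck–Huveneers' on-site-dominated anti-continuum class; the
DRH window is the intermediate stretch of rays with `b/a ≪ 1`. -/

/-- The witness-level conjugacy `W(lam, β; T) ⇔ W(lam T, β T; 1)` (`T > 0`), as a hypothesis. -/
def UnitTempConjugacy : Prop :=
  ∀ ω₂ lam β γ T : ℝ, 0 < T → (AbelWitness ω₂ lam β γ T ↔ AbelWitness ω₂ (lam * T) (β * T) γ 1)

/-- The DLR clause of `UnitTempConjugacy` IS tree content: Gibbs states at `T` of the `(lam, β)`
chain exist iff Gibbs states at `1` of the `(lam T, β T)` chain do. -/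
theorem gibbsClause_unit_temp (ω₂ lam β γ : ℝ) {T : ℝ} (hT : 0 < T) :
    (∃ μ : Measure ChainConfig, (pinnedChain ω₂ lam β γ).IsChainGibbsMeasure T μ) ↔
      ∃ μ : Measure ChainConfig, (pinnedChain ω₂ (lam * T) (β * T) γ).IsChainGibbsMeasure 1 μ :=
  exists_isChainGibbsMeasure_iff_unit_temp ω₂ lam β γ hT

/-- RAY PROPAGATION at unit temperature along `c ↦ (a c, b c)`. -/
def RayPropagation : Prop :=
  ∀ ω₂ a b γ : ℝ, 0 < ω₂ → 0 < a → 0 < b → 0 < γ →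
    ∀ c₀ : ℝ, 0 < c₀ → (∀ c : ℝ, 0 < c → c < c₀ → AbelWitness ω₂ (a * c) (b * c) γ 1) →
      ∀ c : ℝ, 0 < c → AbelWitness ω₂ (a * c) (b * c) γ 1

/-- **RAY FORM OF THE CRUX** (under the conjugacy): `GreenKuboContinuation ↔ RayPropagation`. -/
theorem greenKuboContinuation_iff_ray (hconj : UnitTempConjugacy) :
    GreenKuboContinuation ↔ RayPropagation := by
  rw [greenKuboContinuation_iff]
  constructor
  · intro h ω₂ a b γ hω ha hb hγ c₀ hc₀ hc c hcpos
    have hcorner : ∀ T : ℝ, 0 < T → T < c₀ → AbelWitness ω₂ a b γ T :=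
      fun T hT hlt => (hconj ω₂ a b γ T hT).2 (hc T hT hlt)
    exact (hconj ω₂ a b γ c hcpos).1 (h ω₂ a b γ hω ha hb hγ c₀ hc₀ hcorner c hcpos)
  · intro h ω₂ lam β γ hω hl hβ hγ T₀ hT₀ hc T hT
    have hray : ∀ c : ℝ, 0 < c → c < T₀ → AbelWitness ω₂ (lam * c) (β * c) γ 1 :=
      fun c hcpos hlt => (hconj ω₂ lam β γ c hcpos).1 (hc c hcpos hlt)
    exact (hconj ω₂ lam β γ T hT).2 (h ω₂ lam β γ hω hl hβ hγ T₀ hT₀ hray T hT)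

/-- **THRESHOLD NORMALISATION** (under the conjugacy): it suffices to prove the crux for `T₀ = 1`,
i.e. `(∀ T ∈ (0,1), W T) → ∀ T > 0, W T` for all positive couplings — replace `(lam, β)` by
`(lam T₀, β T₀)`. -/
theorem greenKuboContinuation_iff_unit_threshold (hconj : UnitTempConjugacy) :
    GreenKuboContinuation ↔
      ∀ ω₂ lam β γ : ℝ, 0 < ω₂ → 0 < lam → 0 < β → 0 < γ →
        (∀ T : ℝ, 0 < T → T < 1 → AbelWitness ω₂ lam β γ T) → ∀ T : ℝ, 0 < T → AbelWitness ω₂ lam β γ T := by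
  rw [greenKuboContinuation_iff]
  constructor
  · intro h ω₂ lam β γ hω hl hβ hγ hc
    exact h ω₂ lam β γ hω hl hβ hγ 1 one_pos hc
  · intro h ω₂ lam β γ hω hl hβ hγ T₀ hT₀ hc T hT
    -- rescale: W(lam,β; T) ⇔ W(lam T₀, β T₀; T/T₀)
    have key : ∀ S : ℝ, 0 < S → (AbelWitness ω₂ lam β γ (S * T₀) ↔ AbelWitness ω₂ (lam * T₀) (β * T₀) γ S) := by
      intro S hS
      rw [hconj ω₂ lam β γ (S * T₀) (mul_pos hS hT₀), hconj ω₂ (lam * T₀) (β * T₀) γ S hS]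
      ring_nf
    have hc' : ∀ S : ℝ, 0 < S → S < 1 → AbelWitness ω₂ (lam * T₀) (β * T₀) γ S := by
      intro S hS hS1
      have := hc (S * T₀) (mul_pos hS hT₀) (by nlinarith)
      exact (key S hS).1 this
    have hall := h ω₂ (lam * T₀) (β * T₀) γ hω (mul_pos hl hT₀) (mul_pos hβ hT₀) hγ hc' (T / T₀)
      (div_pos hT hT₀)
    have e : T / T₀ * T₀ = T := div_mul_cancel₀ T hT₀.ne'
    rw [← e]
    exact (key (T / T₀) (div_pos hT hT₀)).2 hall

/-- RAY SATURATION (under the conjugacy): a witness at `(lam, β; T)` is a witness at every point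
`(lam T/S, β T/S; S)` of its conjugacy class — the witness set in `(lam, β, T)`-space is a union
of the curves `{(a/S, b/S, S) : S > 0}`; the crux asks whether containing the germ of such a
family at the corner forces containing all of it. -/
theorem abelWitness_conjugacyClass (hconj : UnitTempConjugacy) {ω₂ lam β γ T S : ℝ}
    (hT : 0 < T) (hS : 0 < S) (h : AbelWitness ω₂ lam β γ T) :
    AbelWitness ω₂ (lam * T / S) (β * T / S) γ S := by
  rw [hconj _ _ _ _ S hS]
  rw [hconj _ _ _ _ T hT] at h
  have e1 : lam * T / S * S = lam * T := div_mul_cancel₀ _ hS.ne'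
  have e2 : β * T / S * S = β * T := div_mul_cancel₀ _ hS.ne'
  rw [e1, e2]
  exact h

/-- **THE CONJUGACY HOLDS** (tree: `InfiniteChainAmplitudeScaling.exists_abelWitness_iff_unit_temp`,
landed by this seat as p69671). -/
theorem unitTempConjugacy_holds : UnitTempConjugacy :=
  fun ω₂ lam β γ _T hT => exists_abelWitness_iff_unit_temp ω₂ lam β γ hT

/-- **RAY FORM, UNCONDITIONAL**: `GreenKuboContinuation ↔ RayPropagation`. -/
theorem greenKuboContinuation_iff_ray' : GreenKuboContinuation ↔ RayPropagation :=
  greenKuboContinuation_iff_ray unitTempConjugacy_holds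

/-- **THRESHOLD NORMALISATION, UNCONDITIONAL**: the crux is its own `T₀ = 1` instance. -/
theorem greenKuboContinuation_iff_unit_threshold' :
    GreenKuboContinuation ↔
      ∀ ω₂ lam β γ : ℝ, 0 < ω₂ → 0 < lam → 0 < β → 0 < γ →
        (∀ T : ℝ, 0 < T → T < 1 → AbelWitness ω₂ lam β γ T) → ∀ T : ℝ, 0 < T → AbelWitness ω₂ lam β γ T :=
  greenKuboContinuation_iff_unit_threshold unitTempConjugacy_holds

/-- WITNESS AT `T` ⇔ UNIT-TEMPERATURE WITNESS OF THE RESCALED CHAIN (unconditional). -/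
theorem abelWitness_iff_unit_temp {ω₂ lam β γ T : ℝ} (hT : 0 < T) :
    AbelWitness ω₂ lam β γ T ↔ AbelWitness ω₂ (lam * T) (β * T) γ 1 :=
  unitTempConjugacy_holds ω₂ lam β γ T hT

/-- CONJUGACY CLASSES, UNCONDITIONAL: a witness at `(lam, β; T)` gives one at
`(lam T/S, β T/S; S)` for every `S > 0`. In particular the witness set of the crux's fixed chain
`(lam, β)` at temperatures `T ∈ (0, T₀)` is the same datum as the unit-temperature witness set on
the initial SEGMENT `{(lam T, β T) : T < T₀}` of its coupling ray. -/
theorem abelWitness_conjugacyClass' {ω₂ lam β γ T S : ℝ} (hT : 0 < T) (hS : 0 < S)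
    (h : AbelWitness ω₂ lam β γ T) : AbelWitness ω₂ (lam * T / S) (β * T / S) γ S :=
  abelWitness_conjugacyClass unitTempConjugacy_holds hT hS h

/-- ALL-`T` ABELIAN GREEN–KUBO ⇔ ITS UNIT-TEMPERATURE SLICE over the whole coupling quadrant: the
unconditional statement the crux is sandwiched against (§4) is a statement about `T = 1` only. -/
theorem abelianGreenKuboAllT_iff_unit_temp :
    AbelianGreenKuboAllT ↔
      ∀ ω₂ lam β γ : ℝ, 0 < ω₂ → 0 < lam → 0 < β → 0 < γ → AbelWitness ω₂ lam β γ 1 := by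
  constructor
  · intro h ω₂ lam β γ hω hl hβ hγ
    exact h ω₂ lam β γ hω hl hβ hγ 1 one_pos
  · intro h ω₂ lam β γ hω hl hβ hγ T hT
    rw [abelWitness_iff_unit_temp hT]
    exact h ω₂ (lam * T) (β * T) γ hω (mul_pos hl hT) (mul_pos hβ hT) hγ

/-- **WHAT A PROVER ACTUALLY HAS TO SHOW** (corner-free sufficient condition): unit-temperature
Abelian Green–Kubo for every pinned doubly-quartic chain of the open coupling quadrant implies the
crux (and is equivalent to `AbelianGreenKuboAllT`). The corner hypothesis is usable only by a
genuine CONTINUATION mechanism; absent one, this is the target. -/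
theorem greenKuboContinuation_of_unit_temp_allCouplings
    (h : ∀ ω₂ lam β γ : ℝ, 0 < ω₂ → 0 < lam → 0 < β → 0 < γ → AbelWitness ω₂ lam β γ 1) :
    GreenKuboContinuation :=
  greenKuboContinuation_of_allT (abelianGreenKuboAllT_iff_unit_temp.2 h)

/-! ## §6 Tightness of the ideators' levers (cycle 2)

The three crux idea cards (`Cruxes/GreenKuboContinuation/Ideas/`) propagate the corner witness by
(a) a continuity method on the connected ray (open + relatively closed witness set; closedness via
Moore–Osgood for Poisson integrals under an EQUI-modulus: `EquiAbelClosedness`), (b) an identity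
theorem for REAL-ANALYTIC Mazur overlaps, (c) a thermal-exponent transport. The lemmas below show
the capitalised hypotheses are load-bearing: without them the propagation step is FALSE already
at the level of pure analysis. -/

/-- The Poisson/Abel kernel integrated against a Dirac mass. -/
theorem integral_poisson_dirac (a ν : ℝ) :
    ∫ ω, ν / (ν ^ 2 + ω ^ 2) ∂(Measure.dirac a) = ν / (ν ^ 2 + a ^ 2) := by
  rw [integral_dirac]

/-- **ABEL LIMITS ARE NOT WEAKLY CLOSED** (tightness of `EquiAbelClosedness`, card
ray-continuation-open-closed: its uniform modulus `ϖ` cannot be dropped). The current spectral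
measures `σ_n = δ_{1/(n+1)}` converge weakly to `σ_* = δ_0`; each `σ_n` has Abel limit
`lim_{ν↓0} ∫ ν/(ν²+ω²) dσ_n = 0`, but `∫ ν/(ν²+ω²) dσ_* = 1/ν` has NO finite limit (an atom AT `0` =
a Drude weight: the limit point is ballistic). Physically: a sequence of normal conductors whose
low-frequency spectral weight concentrates towards `ω = 0` can converge to a ballistic point; only
an `n`-uniform rate of the `ν ↓ 0` limit excludes this. -/
theorem abelLimit_not_weakly_closed :
    ∃ (σ : ℕ → Measure ℝ) (σ' : Measure ℝ),
      (∀ n, IsFiniteMeasure (σ n)) ∧ IsFiniteMeasure σ' ∧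
      (∀ g : ℝ → ℝ, Continuous g →
        Tendsto (fun n => ∫ x, g x ∂σ n) atTop (𝓝 (∫ x, g x ∂σ'))) ∧
      (∀ n, Tendsto (fun ν : ℝ => ∫ ω, ν / (ν ^ 2 + ω ^ 2) ∂σ n) (𝓝[>] (0 : ℝ)) (𝓝 0)) ∧
      ¬ ∃ L : ℝ, Tendsto (fun ν : ℝ => ∫ ω, ν / (ν ^ 2 + ω ^ 2) ∂σ') (𝓝[>] (0 : ℝ)) (𝓝 L) := by
  refine ⟨fun n => Measure.dirac (1 / ((n : ℝ) + 1)), Measure.dirac 0, fun n => inferInstance,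
    inferInstance, ?_, ?_, ?_⟩
  · intro g hg
    simp only [integral_dirac]
    exact (hg.tendsto 0).comp tendsto_one_div_add_atTop_nhds_zero_nat
  · intro n
    simp only [integral_poisson_dirac]
    have hpos : (0 : ℝ) < 1 / ((n : ℝ) + 1) := by positivity
    have hcont : Continuous fun ν : ℝ => ν / (ν ^ 2 + (1 / ((n : ℝ) + 1)) ^ 2) := by
      refine Continuous.div continuous_id (by fun_prop) fun ν => ?_
      have : (0 : ℝ) < (1 / ((n : ℝ) + 1)) ^ 2 := by positivity
      nlinarith [sq_nonneg ν]
    have h := hcont.tendsto 0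
    simp only [zero_div] at h
    exact h.mono_left nhdsWithin_le_nhds
  · rintro ⟨L, hL⟩
    simp only [integral_poisson_dirac] at hL
    have hinv : Tendsto (fun ν : ℝ => ν / (ν ^ 2 + (0 : ℝ) ^ 2)) (𝓝[>] (0 : ℝ)) atTop := by
      refine (tendsto_inv_nhdsGT_zero (𝕜 := ℝ)).congr' ?_
      filter_upwards [self_mem_nhdsWithin] with ν hν
      have hν' : (ν : ℝ) ≠ 0 := (mem_Ioi.mp hν).ne'
      field_simp
      ring
    exact not_tendsto_nhds_of_tendsto_atTop hinv L hL

/-- **VANISHING ON THE CORNER PROPAGATES ONLY UNDER ANALYTICITY** (tightness of the identity-theorem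
lever, card overlap-rigidity-analytic-continuation): a `C^∞` function of temperature can vanish on
`(0, 1]` and be non-zero at `T = 2` (`expNegInvGlue (T - 1)`). Real-analyticity of the Mazur
overlaps in `T` (1-D transfer operator) is therefore load-bearing, smoothness is not enough. -/
theorem corner_vanishing_not_smooth_rigid :
    ∃ f : ℝ → ℝ, ContDiff ℝ ((⊤ : ℕ∞) : WithTop ℕ∞) f ∧ (∀ T : ℝ, T ≤ 1 → f T = 0) ∧ f 2 ≠ 0 := by
  refine ⟨fun T => expNegInvGlue (T - 1), ?_, fun T hT => ?_, ?_⟩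
  · exact (expNegInvGlue.contDiff (n := ⊤)).comp (contDiff_id.sub contDiff_const)
  · exact expNegInvGlue.zero_of_nonpos (by linarith)
  · exact (expNegInvGlue.pos_of_pos (by norm_num)).ne'

/-- **PSEUDOGAP = THIRD KILL MECHANISM** (`κ_A = 0`), conditional on the route's own support lemma
`AbelOfSpectralDensity` (stmt-12598, provable now): if the current spectral measure has a
continuous density near `0` with `g(0) = 0`, the Abel functional tends to `0`, so that pair
`(μ, D)` is NOT a witness (`κ > 0` fails). Localisation need not produce an atom or a missing
limit — a soft gap suffices; conversely a prover must show `g_T(0) > 0`, not merely continuity. -/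
theorem no_witness_of_pseudogap (hA : AbelOfSpectralDensity) {P : OscillatorChain}
    (D : InfiniteChainDynamics P) (μ : Measure ChainConfig) (T : ℝ)
    (σ : Measure ℝ) [IsFiniteMeasure σ] (δ : ℝ) (g : ℝ → ℝ) (hδ : 0 < δ)
    (hC : ∀ t : ℝ, D.currentCorrelation μ t = ∫ ω, Real.cos (ω * t) ∂σ)
    (hg : ContinuousOn g (Ioo (-δ) δ)) (hg0 : ∀ ω ∈ Ioo (-δ) δ, 0 ≤ g ω)
    (hσ : σ.restrict (Ioo (-δ) δ) = (volume.restrict (Ioo (-δ) δ)).withDensity fun ω => ENNReal.ofReal (g ω))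
    (hgap : g 0 = 0) {κ : ℝ} (hκ : 0 < κ) :
    ¬ Tendsto (fun ν : ℝ => (T ^ 2)⁻¹ * ∫ t in Ioi (0 : ℝ),
        Real.exp (-(ν * t)) * D.currentCorrelation μ t) (𝓝[>] (0 : ℝ)) (𝓝 κ) := by
  intro h
  have h0 := (hA σ (D.currentCorrelation μ) δ g inferInstance hδ hC hg hg0 hσ).const_mul ((T ^ 2)⁻¹)
  rw [hgap, mul_zero, mul_zero] at h0
  exact hκ.ne' (tendsto_nhds_unique h h0)

end Summit.AtomisticToContinuum.FouriersLaw.Cruxes.GreenKuboContinuation.Disproof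

end
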